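import Literature.NumberTheory.Irrationality.RivoalZudilin2020.TwoIrrationalOddZetaValues
import Literature.NumberTheory.Transcendental.PartialFractions
import Literature.Analysis.Calculus.DividedDerivatives
import HarnessLib

/-!
# Rivoal–Zudilin 2020, §2: the partial fractions of `R(t)` with the Taylor coefficients `p_{j,m}` (proofs)

Topic `Literature/NumberTheory/Irrationality/RivoalZudilin2020`; proofs-only companion of
`TwoIrrationalOddZetaValues.lean` (no new definition, no new named fact). Source: T. Rivoal, W. Zudilin,
*A note on odd zeta values*, Sém. Lothar. Combin. **81** (2020) B81b = arXiv:1803.03160 [RivoalZudilin2020], §2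
and the first half of the proof of Proposition 1 (i) (§3).

For `R(t) = n!^{A−15} 2^{18n} (2t+n) (t−n)_n³ (t+n+1)_n³ (t−n+½)_{3n}³ / (t)_{n+1}^A` (`rfun A n`) and the typed
Taylor coefficients `p_{j,m} = (1/(A−j)!) (R(t)(t+m)^A)^{(A−j)}|_{t=−m}` (`pCoeff A n j m`, through the regularised
function `rfunReg A n m = R(t)(t+m)^A`) this file PROVES, for `A ≥ 15` (the source has `A ≥ 15` in §2 and `A ≥ 16` even in Proposition 1):

* `rfun_eq_sum_pCoeff` — the partial-fraction expansion (5) of the source,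
  `R(t) = Σ_{m=0}^{n} Σ_{j=1}^{A} p_{j,m} (t+m)^{−j}` off the poles `0, −1, …, −n`: "The degree of `R(t)` is
  `(15−A)n−A+1 ≤ −2` so that the partial fraction expansion is (5) with (the `p_{j,m}`)". EXISTENCE of an expansion
  with poles of order `≤ A` is the tree's `Transcendental.exists_pfEval_eq_eval_mul_prod_inv` (numerator degree
  `15n+1 <` number of linear factors `A(n+1)`); its coefficients are then IDENTIFIED with the `p_{j,m}` by comparing
  germs at `−m` (divided derivatives, `Literature.Analysis.Calculus.divDeriv`), exactly as in the tree's
  `Transcendental/ZudilinCoefficients.lean` for Zudilin's `R_n`;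
* the plumbing used by the sibling `WellPoisedReflectionProofs.lean` (reflection `p_{j,n−m} = (−1)^{j+1}p_{j,m}`,
  residue `Σ_m p_{1,m} = 0`) and `LinearFormsProofs.lean` (Proposition 1 (i)): `rfunReg_eq_rfun_mul`,
  `contDiffAt_rfunReg`, `pCoeff_eq_divDeriv`.

HONEST FRAMING (cells pub-zeta5 / zeta5-irr): systematic search; no irrationality claim unless certified — these are
identities of rational functions and of their Taylor coefficients; nothing here concerns the arithmetic of any
zeta value (Proposition 1 (ii), the denominators, is untouched).
-/

noncomputable section

open Finset Filter Topology Polynomial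
open Literature.Analysis.Calculus
open Literature.NumberTheory.Transcendental (pfEval IsPF exists_pfEval_eq_eval_mul_prod_inv)
open scoped Nat

namespace Literature.NumberTheory.Irrationality.RivoalZudilin2020

/-! ### The regularised function `R(t)(t+m)^A` -/

/-- Off the pole `−m` (`0 ≤ m ≤ n`), `rfunReg A n m t = R(t)·(t+m)^A`. [cite: RivoalZudilin2020, §2 (3)] -/
theorem rfunReg_eq_rfun_mul (A n : ℕ) {m : ℕ} (hm : m ∈ range (n + 1)) {t : ℝ} (ht : t + m ≠ 0) :
    rfunReg A n m t = rfun A n t * (t + m) ^ A := by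
  unfold rfun rfunReg
  rw [← Finset.mul_prod_erase _ (fun k : ℕ => (t + (k : ℝ)) ^ A) hm, mul_comm ((t + (m : ℝ)) ^ A),
    div_mul_eq_mul_div, mul_div_mul_right _ _ (pow_ne_zero _ ht)]

/-- The numerator `n!^{A−15} 2^{18n} (2t+n) (t−n)_n³ (t+n+1)_n³ (t−n+½)_{3n}³` of `R` is smooth. [folklore] -/
private theorem contDiff_num (A n : ℕ) {N : WithTop ℕ∞} : ContDiff ℝ N (fun t : ℝ =>
    (n ! : ℝ) ^ (A - 15) * 2 ^ (18 * n) * (2 * t + n) *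
      ((∏ i ∈ range n, (t - n + i)) ^ 3 * (∏ i ∈ range n, (t + n + 1 + i)) ^ 3 *
        (∏ i ∈ range (3 * n), (t - n + 1 / 2 + i)) ^ 3)) := by
  fun_prop

/-- The regularised function `R(t)(t+m)^A` of (3) is smooth at every point `x` off the OTHER poles (`x + k ≠ 0`
for `k ≤ n`, `k ≠ m`). [cite: RivoalZudilin2020, §2 (3)] -/
theorem contDiffAt_rfunReg (A n m : ℕ) {x : ℝ} (hx : ∀ k ∈ (range (n + 1)).erase m, x + k ≠ 0)
    {N : WithTop ℕ∞} : ContDiffAt ℝ N (rfunReg A n m) x := by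
  unfold rfunReg
  refine (contDiff_num A n).contDiffAt.div (by fun_prop) ?_
  exact prod_ne_zero_iff.2 fun k hk => pow_ne_zero _ (hx k hk)

/-- The regularised function `R(t)(t+m)^A` of (3) is smooth at its own centre `−m`, where (3) differentiates it.
[cite: RivoalZudilin2020, §2 (3)] -/
theorem contDiffAt_rfunReg_neg (A n : ℕ) {m : ℕ} {N : WithTop ℕ∞} :
    ContDiffAt ℝ N (rfunReg A n m) (-(m : ℝ)) := by
  refine contDiffAt_rfunReg A n m fun k hk => ?_
  have hkm : k ≠ m := (mem_erase.1 hk).1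
  rw [show (-(m : ℝ) + k) = ((k : ℤ) - (m : ℤ) : ℤ) by push_cast; ring]
  exact_mod_cast sub_ne_zero.2 (by exact_mod_cast hkm : (k : ℤ) ≠ m)

/-- The typed Taylor coefficient is a divided derivative: `p_{j,m} = 𝒟_{A−j}[R(t)(t+m)^A](−m)`.
[cite: RivoalZudilin2020, §2 (3)] -/
theorem pCoeff_eq_divDeriv (A n j m : ℕ) :
    pCoeff A n j m = divDeriv (A - j) (rfunReg A n m) (-(m : ℝ)) := by
  rw [pCoeff, divDeriv, one_div_mul_eq_div]

/-! ### Existence of a partial-fraction expansion with poles of order `≤ A` -/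

/-- `R(t)` is a polynomial of degree `≤ 15n+1` times `∏_{m ≤ n} ((t+m)⁻¹)^A`; hence (tree:
`Transcendental.exists_pfEval_eq_eval_mul_prod_inv`, `15n + 1 < A(n+1)`) it has SOME expansion
`Σ_{m ≤ n} Σ_{s=1}^{A} c_{m,s} (t+m)^{−s}` off the poles. [cite: RivoalZudilin2020, §2 (5) (existence)] -/
theorem exists_rfun_eq_pfEval (A n : ℕ) (hA : 15 ≤ A) : ∃ c : ℕ → ℕ → ℝ, ∀ t : ℝ,
    (∀ i ∈ range (n + 1), t + i ≠ 0) → rfun A n t = pfEval (range (n + 1)) (fun _ => A) c t := by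
  classical
  set P : ℝ[X] := C ((n ! : ℝ) ^ (A - 15) * 2 ^ (18 * n)) * (C 2 * X + C (n : ℝ)) *
      ((∏ i ∈ range n, (X + C ((i : ℝ) - n))) ^ 3 * (∏ i ∈ range n, (X + C ((n : ℝ) + 1 + i))) ^ 3 *
        (∏ i ∈ range (3 * n), (X + C ((i : ℝ) - n + 1 / 2))) ^ 3) with hP
  set L : List ℕ := (range (n + 1)).toList.flatMap fun i => List.replicate A i with hL
  -- degree of the numerator
  have hlin : ∀ u : ℝ, (X + C u : ℝ[X]).natDegree ≤ 1 := fun u => (natDegree_X_add_C u).le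
  have hprod : ∀ (k : ℕ) (u : ℕ → ℝ), (∏ i ∈ range k, (X + C (u i) : ℝ[X])).natDegree ≤ k := by
    intro k u
    refine (natDegree_prod_le _ _).trans ?_
    refine (sum_le_sum (g := fun _ => 1) fun i _ => hlin _).trans ?_
    simp
  have hdegP : P.natDegree ≤ 15 * n + 1 := by
    have h0 : (C ((n ! : ℝ) ^ (A - 15) * 2 ^ (18 * n)) * (C 2 * X + C (n : ℝ)) : ℝ[X]).natDegree ≤ 1 :=
      (natDegree_C_mul_le _ _).trans natDegree_linear_le
    have h1 := (natDegree_pow_le (p := ∏ i ∈ range n, (X + C ((i : ℝ) - n))) (n := 3)).trans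
      (Nat.mul_le_mul_left 3 (hprod n fun i => (i : ℝ) - n))
    have h2 := (natDegree_pow_le (p := ∏ i ∈ range n, (X + C ((n : ℝ) + 1 + i))) (n := 3)).trans
      (Nat.mul_le_mul_left 3 (hprod n fun i => (n : ℝ) + 1 + i))
    have h3 := (natDegree_pow_le (p := ∏ i ∈ range (3 * n), (X + C ((i : ℝ) - n + 1 / 2))) (n := 3)).trans
      (Nat.mul_le_mul_left 3 (hprod (3 * n) fun i => (i : ℝ) - n + 1 / 2))
    have h123 := natDegree_mul_le.trans (add_le_add (natDegree_mul_le.trans (add_le_add h1 h2)) h3)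
    refine (natDegree_mul_le.trans (add_le_add h0 h123)).trans ?_
    omega
  -- the list of shifts: length `(n+1)A`, every shift `≤ n`, multiplicity `A`
  have hlen : L.length = (n + 1) * A := by
    rw [hL, List.length_flatMap]
    simp
  have hmem : ∀ i ∈ L, i ∈ range (n + 1) := by
    intro i hi
    rw [hL, List.mem_flatMap] at hi
    obtain ⟨j, hj, hij⟩ := hi
    rw [Finset.mem_toList] at hj
    rwa [(List.mem_replicate.1 hij).2]
  have hcount : ∀ i ∈ range (n + 1), L.count i ≤ A := by
    intro i hi
    rw [hL, List.count_flatMap]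
    have hi' := mem_range.1 hi
    simp [Function.comp_def, List.count_replicate]
    split_ifs <;> omega
  have hdeg : P.natDegree < L.length := by
    rw [hlen]
    have : 15 * n + 1 < (n + 1) * A := by nlinarith
    omega
  obtain ⟨c, hc⟩ := exists_pfEval_eq_eval_mul_prod_inv (range (n + 1)) P L hmem hdeg
  -- `R = P · ∏ (t+i)⁻¹`
  have hR : ∀ t : ℝ, rfun A n t = P.eval t * (L.map fun i : ℕ => (t + (i : ℝ))⁻¹).prod := by
    intro t
    have hprodL : (L.map fun i : ℕ => (t + (i : ℝ))⁻¹).prod = ∏ i ∈ range (n + 1), ((t + (i : ℝ))⁻¹) ^ A := by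
      rw [hL, List.map_flatMap, List.flatMap_def, List.prod_flatten, List.map_map, ← Finset.prod_map_toList]
      refine congrArg List.prod (List.map_congr_left fun u _ => ?_)
      simp [List.prod_replicate]
    rw [hprodL, rfun, hP]
    simp only [eval_mul, eval_C, eval_add, eval_X, eval_pow, eval_prod]
    rw [div_eq_mul_inv, ← prod_inv_distrib]
    congr 1
    · have e1 : ∏ i ∈ range n, (t + ((i : ℝ) - n)) = ∏ i ∈ range n, (t - n + i) :=
        prod_congr rfl fun i _ => by ring
      have e2 : ∏ i ∈ range (3 * n), (t + ((i : ℝ) - n + 1 / 2)) = ∏ i ∈ range (3 * n), (t - n + 1 / 2 + i) :=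
        prod_congr rfl fun i _ => by ring
      have e3 : ∏ i ∈ range n, (t + ((n : ℝ) + 1 + i)) = ∏ i ∈ range n, (t + n + 1 + i) :=
        prod_congr rfl fun i _ => by ring
      rw [e1, e2, e3]
    · exact prod_congr rfl fun i _ => (inv_pow _ _).symm
  have hPF : IsPF (range (n + 1)) (fun i => L.count i) (rfun A n) :=
    ⟨c, fun t ht => (hR t).trans (hc t ht)⟩
  obtain ⟨c', hc'⟩ := hPF.mono hcount
  exact ⟨c', hc'⟩

/-! ### Identification of the coefficients with the `p_{j,m}` -/

/-- Off a point, continuity plus agreement on a punctured neighbourhood gives agreement of germs. [folklore] -/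
private theorem eventuallyEq_of_puncturedNhds {f g : ℝ → ℝ} {x : ℝ} (hf : ContinuousAt f x)
    (hg : ContinuousAt g x) (h : ∀ᶠ t : ℝ in 𝓝[≠] x, f t = g t) : f =ᶠ[𝓝 x] g := by
  have hx : f x = g x := by
    have hf' : Tendsto f (𝓝[≠] x) (𝓝 (f x)) := hf.tendsto.mono_left nhdsWithin_le_nhds
    have hg' : Tendsto g (𝓝[≠] x) (𝓝 (g x)) := hg.tendsto.mono_left nhdsWithin_le_nhds
    exact tendsto_nhds_unique (hf'.congr' h) hg'
  rw [eventually_nhdsWithin_iff] at h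
  filter_upwards [h] with t ht
  by_cases htx : t = x
  · rw [htx, hx]
  · exact ht htx

/-- A punctured neighbourhood of `−m` contains no pole of `R` and not `−m`. [folklore] -/
private theorem eventually_good (n m : ℕ) :
    ∀ᶠ t : ℝ in 𝓝[≠] (-(m : ℝ)), t + m ≠ 0 ∧ ∀ i ∈ range (n + 1), t + i ≠ 0 := by
  have hball : ∀ᶠ t in 𝓝 (-(m : ℝ)), dist t (-(m : ℝ)) < 1 :=
    Metric.eventually_nhds_iff.2 ⟨1, one_pos, fun y hy => hy⟩
  have h1 : ∀ᶠ t in 𝓝[≠] (-(m : ℝ)), t ≠ -(m : ℝ) := eventually_mem_nhdsWithin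
  filter_upwards [h1, mem_nhdsWithin_of_mem_nhds hball] with t ht hdist
  refine ⟨fun h => ht (by linarith), fun i _ h => ?_⟩
  have ht' : t = -(i : ℝ) := by linarith
  have hmi : m ≠ i := by
    rintro rfl
    exact ht ht'
  have hz : ((m : ℤ) - i : ℤ) ≠ 0 := sub_ne_zero.2 (by exact_mod_cast hmi)
  have h1le : (1 : ℝ) ≤ |(((m : ℤ) - i : ℤ) : ℝ)| := by
    rw [← Int.cast_abs]
    exact_mod_cast Int.one_le_abs hz
  have hd : dist t (-(m : ℝ)) = |(((m : ℤ) - i : ℤ) : ℝ)| := by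
    rw [ht', Real.dist_eq]
    push_cast
    congr 1
    ring
  rw [hd] at hdist
  exact absurd hdist (not_lt.2 h1le)

/-- Smoothness of `(t+i)^{−s}` at a point `x` with `x + i ≠ 0`. [folklore] -/
private theorem contDiffAt_inv_pow_of_ne (i s : ℕ) {x : ℝ} (hx : x + i ≠ 0) {N : WithTop ℕ∞} :
    ContDiffAt ℝ N (fun t : ℝ => ((t + i) ^ s)⁻¹) x :=
  ((contDiffAt_id.add contDiffAt_const).pow s).inv (by simpa using pow_ne_zero s hx)

/-- **Identification of the coefficients**: if `R = Σ_{i ≤ n} Σ_{s ≤ A} c_{i,s}(t+i)^{−s}` off the poles, then for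
`m ≤ n` and `a < A`, `𝒟_a[R(t)(t+m)^A](−m) = c_{m,A−a}` — so the coefficient of `(t+m)^{−j}` is `p_{j,m}`.
[cite: RivoalZudilin2020, §2 (3) and (5)] -/
theorem divDeriv_rfunReg_eq_coeff (A n : ℕ) {c : ℕ → ℕ → ℝ}
    (hc : ∀ t : ℝ, (∀ i ∈ range (n + 1), t + i ≠ 0) → rfun A n t = pfEval (range (n + 1)) (fun _ => A) c t)
    {m : ℕ} (hm : m ∈ range (n + 1)) {a : ℕ} (ha : a < A) :
    divDeriv a (rfunReg A n m) (-(m : ℝ)) = c m (A - a) := by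
  -- the regular part `H` and the candidate germ `F`
  set H : ℝ → ℝ := fun t => ∑ i ∈ (range (n + 1)).erase m, ∑ s ∈ Icc 1 A, c i s * ((t + i) ^ s)⁻¹ with hH
  set F : ℝ → ℝ := fun t => ∑ s ∈ Icc 1 A, c m s * (t - (-(m : ℝ))) ^ (A - s)
    + (t - (-(m : ℝ))) ^ A * H t with hF
  have hHs : ContDiffAt ℝ (⊤ : ℕ∞) H (-(m : ℝ)) := by
    refine ContDiffAt.sum fun i hi => ContDiffAt.sum fun s _ => contDiffAt_const.mul ?_
    refine contDiffAt_inv_pow_of_ne i s ?_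
    have him : i ≠ m := (mem_erase.1 hi).1
    rw [show (-(m : ℝ) + i) = ((i : ℤ) - (m : ℤ) : ℤ) by push_cast; ring]
    exact_mod_cast sub_ne_zero.2 (by exact_mod_cast him : (i : ℤ) ≠ m)
  have hterm : ∀ s ∈ Icc 1 A, ContDiffAt ℝ (⊤ : ℕ∞)
      (fun t : ℝ => c m s * (t - (-(m : ℝ))) ^ (A - s)) (-(m : ℝ)) := fun s _ =>
    contDiffAt_const.mul (contDiffAt_sub_pow _ _ _)
  have hFs : ContDiffAt ℝ (⊤ : ℕ∞) F (-(m : ℝ)) :=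
    (ContDiffAt.sum fun s hs => hterm s hs).add ((contDiffAt_sub_pow _ _ _).mul hHs)
  -- `rfunReg = F` near `-m`
  have hGF : rfunReg A n m =ᶠ[𝓝 (-(m : ℝ))] F := by
    refine eventuallyEq_of_puncturedNhds (contDiffAt_rfunReg_neg A n (N := 0)).continuousAt
      hFs.continuousAt ?_
    filter_upwards [eventually_good n m] with t ht
    rw [rfunReg_eq_rfun_mul A n hm ht.1, hc t ht.2, pfEval, ← add_sum_erase _ _ hm, hF, hH]
    simp only [sub_neg_eq_add]
    rw [add_mul, sum_mul, mul_comm _ (H t)]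
    congr 1
    refine sum_congr rfl fun s hs => ?_
    have hs' := (mem_Icc.1 hs).2
    rw [mul_assoc]
    congr 1
    have hpow : (t + m) ^ A = (t + m) ^ s * (t + m) ^ (A - s) := by
      rw [← pow_add]; congr 1; omega
    rw [hpow, ← mul_assoc, inv_mul_cancel₀ (pow_ne_zero s ht.1), one_mul]
  -- compute the divided derivative of `F`
  rw [divDeriv_congr hGF, hF]
  have ha' : ContDiffAt ℝ a (fun t => (t - (-(m : ℝ))) ^ A * H t) (-(m : ℝ)) :=
    ((contDiffAt_sub_pow _ _ _).mul hHs).of_le (mod_cast le_top)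
  rw [divDeriv_fun_add ((ContDiffAt.sum fun s hs => hterm s hs).of_le (mod_cast le_top)) ha',
    divDeriv_sub_pow_mul (hHs.of_le (mod_cast le_top)) A, if_pos ha, add_zero,
    divDeriv_sum fun s hs => (hterm s hs).of_le (mod_cast le_top)]
  simp_rw [divDeriv_const_mul, divDeriv_sub_pow]
  rw [sum_eq_single_of_mem (A - a) (mem_Icc.2 ⟨by omega, by omega⟩)]
  · rw [if_pos (by omega), mul_one]
  · intro s hs hsa
    rw [if_neg (by have := mem_Icc.1 hs; omega), mul_zero]

/-- **The partial-fraction expansion (5) of [RivoalZudilin2020] with the Taylor coefficients (3)**: for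
`A ≥ 15` and real `t` off the poles `0, −1, …, −n`,
`R(t) = Σ_{m=0}^{n} Σ_{j=1}^{A} p_{j,m} (t+m)^{−j}`. [cite: RivoalZudilin2020, §2 eq. (5) with (3)] -/
theorem rfun_eq_sum_pCoeff (A n : ℕ) (hA : 15 ≤ A) {t : ℝ} (ht : ∀ i ∈ range (n + 1), t + i ≠ 0) :
    rfun A n t = ∑ m ∈ range (n + 1), ∑ j ∈ Icc 1 A, pCoeff A n j m * ((t + m) ^ j)⁻¹ := by
  obtain ⟨c, hc⟩ := exists_rfun_eq_pfEval A n hA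
  rw [hc t ht, pfEval]
  refine sum_congr rfl fun m hm => sum_congr rfl fun j hj => ?_
  have hj' := mem_Icc.1 hj
  rw [pCoeff_eq_divDeriv, divDeriv_rfunReg_eq_coeff A n hc hm (by omega), show A - (A - j) = j by omega]

end Literature.NumberTheory.Irrationality.RivoalZudilin2020
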